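import Literature.Barriers.CriticalPhenomena.AmenableInvariantPercolationZd

/-!
# The hyperfinite EXHAUSTION form of the barrier `AmenableInvariantPercolation`
# (BLPS 1999, proof of Thm. 5.3; Terlov–Timár 2025, Def. 4.1 / Thm. 1.4) — audit gen-3

Barrier catalogue `Literature/Barriers/CriticalPhenomena/` (D-0021); audit 2026-08-15, gen-3, of
`AmenableInvariantPercolationProofs.lean` / the entry `AmenableInvariantPercolation`
(Lyons–Peres 2016, Thm. 8.37, "amenable ⟹"; PROVED in the tree, `AmenableInvariantPercolation_holds`).
Companion of `AmenableInvariantPercolationHyperfinite.lean` (d̄-density of finite-cluster invariant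
percolations); this file isolates the part that needs only the coin construction of the Proofs
file.

## What is proved

The literature's name for the obstruction behind Thm. 8.37 is HYPERFINITENESS: "Let `Γ` be a
closed subgroup of `Aut(G)` that acts transitively on `G` … Suppose `ω` is an invariant random
subgraph of `G`. We say that `ω` is *hyperfinite* if there is an increasing family of random
subgraphs `ω_1 ⊆ ω_2 ⊆ … ⊆ ω` such that (1) the joint law of `(ω, {ω_n})` is `Γ`-invariant,
(2) `⋃ ω_n = ω`, (3) for all `n ≥ 1` all clusters are finite `ω_n`-a.s." (Terlov–Timár 2025,
Def. 4.1, pp. 19–20), and "`G` is w-amenable ⟺ `G` is level-amenable ⟺ `G` is hyperfinite"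
(ibid., Thm. 1.4; for unimodular `Γ` the weights are `≡ 1` and w-amenability is amenability),
whose amenable direction "(1) ⟺ (3) was essentially shown in [BLPS99b, Theorem 5.1] … in fact,
their proof gives that a w-amenable graph `G` admits a factor of iid hyperfinite exhaustion"
(ibid., p. 21). The printed source of the exhaustion is the proof of BLPS 1999 (GAFA), Thm. 5.3,
p. 52: "From the proof of Theorem 5.1, we obtain a sequence of invariant site percolations with
configurations `ω̃_1 ⊂ ω̃_2 ⊂ ⋯` with each of them having no infinite components and with the
marginals tending to `1`: namely, let `ω̂_n := ⋂_{k ≥ n} ω_k`, with `ω_k` as in the proof of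
Theorem 5.1."

This file PROVES that statement for the tree's Haar-free variant of the construction
(`AmenableInvariantPercolation_exhaustion`): on a connected, locally finite, transitive, amenable
graph, on the probability space of the independent coins indexed by the copies `γ F_n` of the
Følner sets (`coinMeasure`), the configurations `ω_m := configFrom G F m` — remove the inner
vertex boundaries of the activated copies of levels `n ≥ m` only — satisfy: `ω_0 ⊆ ω_1 ⊆ ⋯`;
the joint law of the sequence is invariant under the diagonal action of every automorphism
(`coinMeasure_map_image_configFrom`), so each `ω_m` is an invariant site percolation
(`isInvariantSitePercolation_percFrom`); every `ω_m` has a.s. only finite clusters ((8.24) of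
Lyons–Peres 2016, proof of Thm. 8.37, run from level `m` on); a.s. `⋃_m ω_m = V` (first
Borel–Cantelli lemma: the level-`n` cost `#{copies C ∋ x on ∂_in C} · q_n ≤ |∂_E F_n|/|F_n|` is
summable, (8.23) ibid.); hence `P[x ∈ ω_m] → 1` for every `x` (monotone convergence).

## Why it matters for the barrier (planner-facing)

The BLPS percolations `ξ_ε` of the uniqueness case of `θ(p_c) = 0` (Lyons–Peres 2016, Thm. 8.21,
proof) form exactly such a monotone family: `ξ_ε ↑ E` as `ε ↓ 0`, all clusters finite, jointly
invariant. On a non-amenable unimodular transitive graph no such exhaustion exists (expected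
degree of finite-cluster invariant percolations stays `≤ d_G - Φ_E(G)`, Lyons–Peres 2016,
Thm. 8.16), which is the contradiction BLPS exploit; on `ℤ³` the present theorem exhibits one
(`AmenableInvariantPercolation_exhaustion_zd`), so the monotone-coupling / exhaustion structure of
`(ξ_ε)_ε` is no lever on `ℤ³` — not only is each density level `α < 1` attained by SOME finite-
cluster invariant percolation (Thm. 8.37), but a single jointly invariant increasing family
attains them all and exhausts the lattice. This is the `scope_caveats:` item "monotone coupled
families are no lever" of the entry `AmenableInvariantPercolation` (audit gen-3), now PROVED.

## Contents (namespace `Literature.Barriers.CriticalPhenomena`)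

* `configFrom G F m` (levels `≥ m` only; `configFrom_zero : configFrom G F 0 = config G F`),
  `configFrom_mono`, `measurable_configFrom`, `mem_configFrom_comp_reindex`, `image_configFrom`,
  `coinMeasure_map_image_configFrom` (JOINT invariance of the family), `percFrom`,
  `percFrom_preimage_image`, `isInvariantSitePercolation_percFrom`, `configFrom_mem_goodEvent`,
  `mem_configFrom_of_forall`;
* `AmenableInvariantPercolation_exhaustion` — the theorem; `AmenableInvariantPercolation_exhaustion_zd`
  — on `ℤ^d`, unconditionally (`zdGraph_connected`, `isGraphTransitive_zdGraph`,
  `isGraphAmenable_zdGraph` of `AmenableInvariantPercolationZd.lean`).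

## References

* I. Benjamini, R. Lyons, Y. Peres, O. Schramm, *Group-invariant percolation on graphs*, GAFA 9
  (1999) 29–66: Thm. 5.1 (p. 50), Thm. 5.3 (proof, p. 52: `ω̂_n := ⋂_{k ≥ n} ω_k`).
  [BenjaminiLyonsPeresSchramm1999]
* G. Terlov, Á. Timár, *Weighted-amenability and percolation*, arXiv:2502.02560 (2025): Def. 4.1
  (pp. 19–20), Thm. 1.4 and its proof (p. 21). [TerlovTimar2025]
* R. Lyons, Y. Peres, *Probability on Trees and Networks*, CUP 2016: Thm. 8.37 (proof,
  pp. 412–413: (8.23), (8.24)), Thm. 8.16, Thm. 8.21 (proof: `ξ_ε`). [LyonsPeres2016]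
* D. Aldous, R. Lyons, *Processes on unimodular random networks*, EJP 12 (2007), §8 (hyperfinite
  unimodular measures; "Amenability Criteria"). [AldousLyons2007]
-/

noncomputable section

namespace Literature.Barriers.CriticalPhenomena

open Literature.Probability.LatticeModels Literature.Probability.Percolation Finset
open MeasureTheory ProbabilityTheory unitInterval Filter Topology

variable {V : Type*} {G : SimpleGraph V}

/-! ### The level-truncated configurations `configFrom m` (levels `n ≥ m` only) -/

section ConfigFrom

variable [DecidableEq V] [G.LocallyFinite]

variable (G) in
/-- The site configuration determined by the coins `η` using only the levels `n ≥ m`: a vertex is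
open unless it lies on the inner vertex boundary of an activated copy of some `F n`, `n ≥ m`
(`configFrom G F 0 = config G F`; cf. `ω̂_n := ⋂_{k ≥ n} ω_k` in
[cite: BenjaminiLyonsPeresSchramm1999, Thm. 5.3 (proof, p. 52)]). [folklore] -/
def configFrom (F : ℕ → Finset V) (m : ℕ) (η : Idx V → Bool) : Set V :=
  {v | ∀ n : ℕ, m ≤ n → ∀ C : Finset V, C ∈ copies G (F n) → η ⟨n, C⟩ = true →
    v ∉ innerBoundary G C}

/-- Unfolding lemma for `configFrom`. [folklore] -/
theorem mem_configFrom {F : ℕ → Finset V} {m : ℕ} {η : Idx V → Bool} {v : V} :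
    v ∈ configFrom G F m η ↔ ∀ n : ℕ, m ≤ n → ∀ C : Finset V, C ∈ copies G (F n) →
      η ⟨n, C⟩ = true → v ∉ innerBoundary G C :=
  Iff.rfl

/-- Level `0` gives back `config`. [folklore] -/
theorem configFrom_zero (F : ℕ → Finset V) (η : Idx V → Bool) :
    configFrom G F 0 η = config G F η := by
  ext v
  rw [mem_configFrom, mem_config]
  exact ⟨fun h n C hC hη => h n (Nat.zero_le n) C hC hη, fun h n _ C hC hη => h n C hC hη⟩

/-- `configFrom` is increasing in the starting level. [folklore] -/
theorem configFrom_mono (F : ℕ → Finset V) (η : Idx V → Bool) {m m' : ℕ} (h : m ≤ m') :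
    configFrom G F m η ⊆ configFrom G F m' η :=
  fun _ hv n hn C hC hη => hv n (h.trans hn) C hC hη

/-- `configFrom` is measurable (countably many measurable conditions on coordinates).
[folklore] -/
theorem measurable_configFrom [Countable V] (F : ℕ → Finset V) (m : ℕ) :
    Measurable (configFrom G F m) := by
  refine measurable_set_iff.2 fun v => ?_
  simp only [mem_configFrom]
  refine Measurable.forall fun n => Measurable.imp measurable_const <| Measurable.forall fun C =>
    Measurable.imp measurable_const (Measurable.imp ?_ measurable_const)
  exact (measurable_pi_apply _).eq_const _

/-- Equivariance of `configFrom` under re-indexing the coins by an automorphism. [folklore] -/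
theorem mem_configFrom_comp_reindex {F : ℕ → Finset V} {m : ℕ} {η : Idx V → Bool} (γ : G ≃g G)
    {v : V} : v ∈ configFrom G F m (η ∘ ⇑(reindex γ.symm)) ↔ γ.symm v ∈ configFrom G F m η := by
  simp only [mem_configFrom, Function.comp_apply, reindex_apply]
  constructor
  · intro h n hn C hC hη hv
    refine h n hn (isoImage γ C) (isoImage_mem_copies γ hC) (by simpa using hη) ?_
    rw [innerBoundary_isoImage, mem_isoImage]
    exact hv
  · intro h n hn C hC hη hv
    refine h n hn (isoImage γ.symm C) (isoImage_mem_copies γ.symm hC) hη ?_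
    rw [innerBoundary_isoImage, mem_isoImage]
    simpa using hv

/-- `γ '' configFrom m η = configFrom m (η ∘ reindex γ⁻¹)`. [folklore] -/
theorem image_configFrom (F : ℕ → Finset V) (m : ℕ) (γ : G ≃g G) (η : Idx V → Bool) :
    (γ : V → V) '' configFrom G F m η = configFrom G F m (η ∘ ⇑(reindex γ.symm)) := by
  ext v
  rw [mem_configFrom_comp_reindex, Set.mem_image]
  constructor
  · rintro ⟨w, hw, rfl⟩
    simpa using hw
  · intro h
    exact ⟨γ.symm v, h, γ.apply_symm_apply v⟩

/-- **Joint invariance** of the whole family `(configFrom m)_m` under the diagonal action of an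
automorphism: acting by `γ` on every level amounts to re-indexing the coins, which preserves the
coin measure. [folklore] -/
theorem coinMeasure_map_image_configFrom [Countable V] (F : ℕ → Finset V) (q : ℕ → I)
    (γ : G ≃g G) :
    (coinMeasure q).map (fun η : Idx V → Bool => fun m : ℕ => (γ : V → V) '' configFrom G F m η) =
      (coinMeasure q).map (fun η : Idx V → Bool => fun m : ℕ => configFrom G F m η) := by
  have hcomp : Measurable fun η : Idx V → Bool => η ∘ ⇑(reindex γ.symm) :=
    measurable_pi_lambda _ fun i => measurable_pi_apply _
  have hmeas : Measurable fun η : Idx V → Bool => fun m : ℕ => configFrom G F m η :=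
    measurable_pi_lambda _ fun m => measurable_configFrom F m
  have hfun : (fun η : Idx V → Bool => fun m : ℕ => (γ : V → V) '' configFrom G F m η) =
      (fun η : Idx V → Bool => fun m : ℕ => configFrom G F m η) ∘
        fun η : Idx V → Bool => η ∘ ⇑(reindex γ.symm) := by
    funext η
    funext m
    exact image_configFrom F m γ η
  rw [hfun, ← Measure.map_map hmeas hcomp, coinMeasure_map_comp_equiv q _ (fun i => rfl)]

variable (G) in
/-- The law of `configFrom m`: push-forward of the coin measure. [folklore] -/
def percFrom (F : ℕ → Finset V) (q : ℕ → I) (m : ℕ) : Measure (Set V) :=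
  (coinMeasure q).map (configFrom G F m)

/-- The law of `configFrom m` is a probability measure (`V` countable). [folklore] -/
instance instIsProbabilityMeasurePercFrom [Countable V] (F : ℕ → Finset V) (q : ℕ → I) (m : ℕ) :
    IsProbabilityMeasure (percFrom G F q m) :=
  Measure.isProbabilityMeasure_map (measurable_configFrom F m).aemeasurable

/-- Automorphism invariance of the law of `configFrom m`. [folklore] -/
theorem percFrom_preimage_image [Countable V] (F : ℕ → Finset V) (q : ℕ → I) (m : ℕ) (γ : G ≃g G)
    {A : Set (Set V)} (hA : MeasurableSet A) :
    percFrom G F q m ((fun ω : Set V => (γ : V → V) '' ω) ⁻¹' A) = percFrom G F q m A := by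
  have hm := measurable_configFrom (G := G) F m
  have hcomp : Measurable fun η : Idx V → Bool => η ∘ ⇑(reindex γ.symm) :=
    measurable_pi_lambda _ fun i => measurable_pi_apply _
  rw [percFrom, Measure.map_apply hm (measurable_image_iso γ hA), Measure.map_apply hm hA,
    ← Set.preimage_comp]
  have : (fun ω : Set V => (γ : V → V) '' ω) ∘ configFrom G F m =
      configFrom G F m ∘ fun η : Idx V → Bool => η ∘ ⇑(reindex γ.symm) :=
    funext (image_configFrom F m γ)
  rw [this, Set.preimage_comp, ← Measure.map_apply hcomp (hm hA),
    coinMeasure_map_comp_equiv q _ (fun i => rfl)]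

/-- The law of `configFrom m` is an invariant site percolation. [folklore] -/
theorem isInvariantSitePercolation_percFrom [Countable V] (F : ℕ → Finset V) (q : ℕ → I) (m : ℕ) :
    IsInvariantSitePercolation G (percFrom G F q m) :=
  ⟨inferInstance, fun γ _ hA => percFrom_preimage_image F q m γ hA⟩

/-- If every vertex lies in an activated copy of level `≥ m` then `configFrom m η ∈ goodEvent`.
[folklore] -/
theorem configFrom_mem_goodEvent {F : ℕ → Finset V} {m : ℕ} {η : Idx V → Bool}
    (h : ∀ x, ∃ n C, m ≤ n ∧ C ∈ through G (F n) x ∧ η ⟨n, C⟩ = true) :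
    configFrom G F m η ∈ goodEvent G := by
  intro x
  obtain ⟨n, C, hn, ⟨hC, hxC⟩, hη⟩ := h x
  exact ⟨C, hxC, fun v hv hvω => (mem_configFrom.1 hvω) n hn C hC hη hv⟩

/-- The level-`n` "bad" event for `x`: some copy of `F n` with `x` on its inner boundary is
activated. Off these events for all `n ≥ m`, `x ∈ configFrom m η`. [folklore] -/
theorem mem_configFrom_of_forall {F : ℕ → Finset V} {m : ℕ} {η : Idx V → Bool} {x : V}
    (B : ℕ → Finset (Finset V))
    (hB : ∀ n C, C ∈ copies G (F n) → x ∈ innerBoundary G C → C ∈ B n)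
    (h : ∀ n, m ≤ n → ∀ C ∈ B n, η ⟨n, C⟩ = false) : x ∈ configFrom G F m η := by
  intro n hn C hC hη hx
  have := h n hn C (hB n C hC hx)
  rw [this] at hη
  exact Bool.false_ne_true hη

end ConfigFrom

/-! ### The exhaustion theorem -/

section Main

/-- **BARRIER, hyperfinite-exhaustion form (audit 2026-08-15, gen-3) — an amenable transitive
graph is exhausted by ONE jointly invariant increasing family of finite-cluster invariant site
percolations.** On a connected, locally finite, transitive, amenable graph `G` there is a
probability space (`coinMeasure q`: independent coins on the copies `γ F_n` of Følner sets) and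
site configurations `ω_0 ⊆ ω_1 ⊆ ⋯` (`ω_m = configFrom G F m`: remove the inner boundaries of the
activated copies of levels `≥ m`) such that: the joint law of `(ω_m)_m` is invariant under the
diagonal action of every automorphism; each `ω_m` is an invariant site percolation with a.s. only
finite clusters; a.s. `⋃_m ω_m = V`; and `P[x ∈ ω_m] → 1` for every vertex `x`. This is the
sequence "`ω̃_1 ⊂ ω̃_2 ⊂ ⋯` with each of them having no infinite components and with the marginals
tending to `1`: namely, let `ω̂_n := ⋂_{k ≥ n} ω_k`" of
[cite: BenjaminiLyonsPeresSchramm1999, Thm. 5.3 (proof, p. 52)], i.e. a *hyperfinite exhaustion*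
in the sense of [cite: TerlovTimar2025, Def. 4.1 (pp. 19–20) and Thm. 1.4 (amenable ⟺ hyperfinite; proof p. 21)],
for the tree's Haar-free variant of the construction of [cite: LyonsPeres2016, Thm. 8.37 (proof, pp. 412–413)]:
finiteness of clusters at level `m` is (8.24) run from level `m` on (`P[no activated copy of F_n
through x for m ≤ n < m + k] ≤ e^{-k}`), and `⋃_m ω_m = V` is the first Borel–Cantelli lemma on the
level costs (8.23), `Σ_n #{C ∋ x on ∂_in C} · q_n ≤ Σ_n |∂_E F_n| / |F_n| < ∞`.

BARRIER (D-0021 structured block; makes the `scope_caveats:` item "monotone coupled families are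
no lever" of `AmenableInvariantPercolation` (audit gen-3) a theorem):
- technique_class: exhaustion / monotone-family versions of the size-blind finite-cluster thresholds — "no jointly invariant increasing family of finite-cluster invariant percolations can have marginals → 1 (or exhaust `V`)", the form in which the BLPS uniqueness-case argument consumes non-amenability through the family `ξ_ε ↑ E` [cite: LyonsPeres2016, Thm. 8.21 (proof) and Thm. 8.16].
- blocks: for `PercolationContinuity 3`, any use of the monotonicity / exhaustion structure of `(ξ_ε)_{ε ↓ 0}` on `ℤ³` beyond what each `ξ_ε` gives separately: `ℤ^d` carries such an exhaustion without any infinite cluster (`AmenableInvariantPercolation_exhaustion_zd`).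
- because: amenable ⟺ hyperfinite [cite: TerlovTimar2025, Thm. 1.4] [cite: BenjaminiLyonsPeresSchramm1999, Thm. 5.1 and Thm. 5.3 (proof, p. 52)]; the Følner/coin witnesses of [cite: LyonsPeres2016, Thm. 8.37 (proof)] are nested by construction (`configFrom_mono`) once all levels live on one coin space, and dropping the first `m` levels costs density `≤ Σ_{n ≥ m} |∂_E F_n| / |F_n| → 0`.
- evasions_known: as for the entry — only cluster-size-sensitive (d̄-discontinuous) functionals of the family survive on `ℤ^d` (profile bound `lintegral_bdryRatio_le_zd`, `AmenableInvariantPercolationProfile.lean`, after [cite: LyonsPeres2016, Cor. 8.38 (proof)]); on NON-amenable unimodular transitive graphs no exhaustion exists [cite: LyonsPeres2016, Thm. 8.16].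
- scope_caveats: site form; `G` connected, locally finite, transitive, amenable, `V : Type`; the sample space is the explicit coin space `Idx V → Bool` of `AmenableInvariantPercolationProofs.lean`, and joint invariance is stated as equality of the push-forward laws of the whole sequence `ℕ → SiteConfig V` under `η ↦ (γ · ω_m η)_m` and `η ↦ (ω_m η)_m`; the factor-of-iid property of the exhaustion [cite: TerlovTimar2025, Thm. 1.4 (proof, p. 21)] is not formalised (the coins are indexed by copies, not by vertices); rates (`P[x ∉ ω_m] ≤ Σ_{n ≥ m} ε_n` for the chosen `ε_n = 2^{-(n+2)}`) are not stated, only `P[x ∈ ω_m] → 1`.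
- status: established (PROVED here) [cite: BenjaminiLyonsPeresSchramm1999, Thm. 5.3 (proof, p. 52)] [cite: TerlovTimar2025, Thm. 1.4]

[cite: BenjaminiLyonsPeresSchramm1999, Thm. 5.3 (proof, p. 52)]
[cite: TerlovTimar2025, Def. 4.1 and Thm. 1.4]
[cite: LyonsPeres2016, Thm. 8.37 (proof, pp. 412–413)] -/
theorem AmenableInvariantPercolation_exhaustion {V : Type} [DecidableEq V] (G : SimpleGraph V)
    [G.LocallyFinite] (hc : G.Connected) (ht : IsGraphTransitive G) (ha : IsGraphAmenable G) :
    ∃ (P : Measure (Idx V → Bool)) (ω : ℕ → (Idx V → Bool) → SiteConfig V),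
      IsProbabilityMeasure P ∧ (∀ m, Measurable (ω m)) ∧
      (∀ γ : G ≃g G, P.map (fun η => fun m => (γ : V → V) '' ω m η) = P.map (fun η => fun m => ω m η)) ∧
      (∀ m, IsInvariantSitePercolation G (P.map (ω m))) ∧
      (∀ m m', m ≤ m' → ∀ η, ω m η ⊆ ω m' η) ∧
      (∀ m, ∀ᵐ η ∂P, ∀ x, (siteCluster G (ω m η) x).Finite) ∧
      (∀ᵐ η ∂P, ∀ x, ∃ m, x ∈ ω m η) ∧
      ∀ x, Tendsto (fun m => (P.map (ω m)).real {ω | x ∈ ω}) atTop (𝓝 1) := by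
  classical
  haveI : Countable V := countable_of_connected hc
  obtain ⟨o⟩ := hc.nonempty
  -- level costs `ε n = 1/2^(n+2)`
  set ε : ℕ → ℝ := fun n => 1 / 2 / 2 / 2 ^ n with hε
  have hεpos : ∀ n, 0 < ε n := fun n => by positivity
  -- Følner sets `F n` with `|∂_E F n| ≤ ε n |F n|`
  choose F hFne hFbd using fun n => ha (ε n) (hεpos n)
  -- `N n` = number of copies of `F n` through a vertex (independent of the vertex)
  set N : ℕ → ℕ := fun n => (through G (F n) o).ncard with hN
  have hNx : ∀ n x, (through G (F n) x).ncard = N n := fun n x => ncard_through_eq ht (F n) x o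
  have hNpos : ∀ n, 0 < N n := fun n =>
    (Set.ncard_pos (through_finite hc (F n) o)).2 (through_nonempty ht (hFne n) o)
  -- activation probabilities `q n = 1 / N n`
  set q : ℕ → I := fun n => ⟨((N n : ℝ))⁻¹, by positivity, Nat.cast_inv_le_one (N n)⟩ with hq
  have hqcoe : ∀ n, (q n : ℝ) = ((N n : ℝ))⁻¹ := fun n => rfl
  have hmeas : ∀ m, Measurable (configFrom G F m) := fun m => measurable_configFrom F m
  /- finite clusters almost surely, at every level `m` -/
  have hfinite : ∀ m, ∀ᵐ η ∂coinMeasure q, ∀ x, (siteCluster G (configFrom G F m η) x).Finite := by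
    intro m
    set T : ℕ → V → Finset (Finset V) := fun n x => (through_finite hc (F n) x).toFinset with hT
    have hTmem : ∀ n x C, C ∈ T n x ↔ C ∈ through G (F n) x := fun n x C =>
      Set.Finite.mem_toFinset _
    have hTcard : ∀ n x, (T n x).card = N n := fun n x => by
      rw [← hNx n x, Set.ncard_eq_toFinset_card _ (through_finite hc (F n) x)]
    -- levels `< m` switched off
    set T' : V → ℕ → Finset (Finset V) := fun x n => if m ≤ n then T n x else ∅ with hT'
    have hnull : ∀ x,
        coinMeasure q {η : Idx V → Bool | ∀ n, m ≤ n → ∀ C ∈ T n x, η ⟨n, C⟩ = false} = 0 := by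
      intro x
      set c : ENNReal := ENNReal.ofReal (Real.exp (-1)) with hc'
      have hc1 : c < 1 := ENNReal.ofReal_lt_one.2 (Real.exp_lt_one_iff.2 (by norm_num))
      have hsub : {η : Idx V → Bool | ∀ n, m ≤ n → ∀ C ∈ T n x, η ⟨n, C⟩ = false} ⊆
          {η : Idx V → Bool | ∀ n, ∀ C ∈ T' x n, η ⟨n, C⟩ = false} := by
        intro η hη n C hC
        by_cases hn : m ≤ n
        · rw [hT'] at hC
          simp only [hn, ↓reduceIte] at hC
          exact hη n hn C hC
        · rw [hT'] at hC
          simp only [hn, ↓reduceIte] at hC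
          exact absurd hC (Finset.notMem_empty C)
      have hfac : ∀ n, (toNNReal (σ (q n)) : ENNReal) ^ (T' x n).card ≤ if m ≤ n then c else 1 := by
        intro n
        by_cases hn : m ≤ n
        · simp only [hT', hn, ↓reduceIte]
          rw [hTcard]
          have hq1 : (toNNReal (σ (q n)) : ENNReal) = ENNReal.ofReal (1 - ((N n : ℝ))⁻¹) := by
            rw [← ENNReal.ofReal_coe_nnreal, coe_toNNReal, coe_symm_eq, hqcoe]
          rw [hq1, ← ENNReal.ofReal_pow (sub_nonneg.2 (Nat.cast_inv_le_one _))]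
          refine ENNReal.ofReal_le_ofReal ?_
          have hN0 : (N n : ℝ) ≠ 0 := by exact_mod_cast (hNpos n).ne'
          calc (1 - ((N n : ℝ))⁻¹) ^ N n ≤ (Real.exp (-((N n : ℝ))⁻¹)) ^ N n :=
                pow_le_pow_left₀ (sub_nonneg.2 (Nat.cast_inv_le_one _))
                  (Real.one_sub_le_exp_neg _) _
            _ = Real.exp (-1) := by
                rw [← Real.exp_nat_mul]
                congr 1
                field_simp
        · simp only [hT', hn, ↓reduceIte, Finset.card_empty, pow_zero, le_refl]
      have hbound : ∀ k,
          coinMeasure q {η : Idx V → Bool | ∀ n, m ≤ n → ∀ C ∈ T n x, η ⟨n, C⟩ = false} ≤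
            c ^ k := by
        intro k
        refine (measure_mono hsub).trans ((coinMeasure_forall_eq_false_le q (T' x) (m + k)).trans ?_)
        calc ∏ n ∈ Finset.range (m + k), (toNNReal (σ (q n)) : ENNReal) ^ (T' x n).card
            ≤ ∏ n ∈ Finset.range (m + k), (if m ≤ n then c else 1) :=
              Finset.prod_le_prod (fun _ _ => zero_le) fun n _ => hfac n
          _ = (∏ n ∈ Finset.range m, (if m ≤ n then c else 1)) *
                ∏ n ∈ Finset.Ico m (m + k), (if m ≤ n then c else 1) :=
              (Finset.prod_range_mul_prod_Ico _ (Nat.le_add_right m k)).symm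
          _ = 1 * c ^ k := by
              congr 1
              · exact Finset.prod_eq_one fun n hn => by
                  simp [not_le.2 (Finset.mem_range.1 hn)]
              · rw [Finset.prod_congr rfl fun n hn => if_pos (Finset.mem_Ico.1 hn).1,
                  Finset.prod_const, Nat.card_Ico, Nat.add_sub_cancel_left]
          _ = c ^ k := one_mul _
      have htend : Tendsto (fun k => c ^ k) atTop (𝓝 0) :=
        ENNReal.tendsto_pow_atTop_nhds_zero_iff.2 hc1
      exact le_antisymm (ge_of_tendsto' htend hbound) zero_le
    -- hence a.s. every vertex lies in an activated copy of level `≥ m`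
    have hW : ∀ᵐ η ∂coinMeasure q,
        ∀ x, ∃ n C, m ≤ n ∧ C ∈ through G (F n) x ∧ η ⟨n, C⟩ = true := by
      rw [ae_iff]
      refine measure_mono_null ?_ (measure_iUnion_null hnull)
      intro η hη
      rw [Set.mem_setOf_eq] at hη
      push Not at hη
      obtain ⟨x, hx⟩ := hη
      simp only [Set.mem_iUnion, Set.mem_setOf_eq]
      refine ⟨x, fun n hn C hC => ?_⟩
      simpa using hx n C hn ((hTmem n x C).1 hC)
    exact hW.mono fun η hη x =>
      finite_siteCluster_of_mem_goodEvent (configFrom_mem_goodEvent hη) x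
  /- almost surely every vertex is eventually open: first Borel–Cantelli lemma -/
  have hexh : ∀ᵐ η ∂coinMeasure q, ∀ x, ∃ m, x ∈ configFrom G F m η := by
    have hBfin : ∀ n x, (bthrough G (F n) x).Finite := fun n x =>
      (through_finite hc (F n) x).subset (bthrough_subset_through _ _)
    set B : V → ℕ → Finset (Finset V) := fun x n => (hBfin n x).toFinset with hB
    have hBmem : ∀ x n C, C ∈ copies G (F n) → x ∈ innerBoundary G C → C ∈ B x n :=
      fun x n C hC hx => (Set.Finite.mem_toFinset _).2 ⟨hC, hx⟩
    -- (8.23): `#B n · q n ≤ |∂_E F n| / |F n| ≤ ε n`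
    have hBcard : ∀ x n, ((B x n).card : ℝ) * (q n : ℝ) ≤ ε n := by
      intro x n
      have h1 := ncard_bthrough_mul_card_le hc ht ha (F n) x
      rw [hNx n x] at h1
      have hcardB : (B x n).card = (bthrough G (F n) x).ncard :=
        (Set.ncard_eq_toFinset_card _ (hBfin n x)).symm
      have hFpos : (0 : ℝ) < (F n).card := by exact_mod_cast (hFne n).card_pos
      have hNpos' : (0 : ℝ) < N n := by exact_mod_cast hNpos n
      have h2 : ((bthrough G (F n) x).ncard : ℝ) * (F n).card ≤ (N n * ε n) * (F n).card := by
        calc ((bthrough G (F n) x).ncard : ℝ) * (F n).card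
            ≤ N n * (edgeBoundary G (F n)).card := by exact_mod_cast h1
          _ ≤ N n * (ε n * (F n).card) := by gcongr; exact hFbd n
          _ = (N n * ε n) * (F n).card := by ring
      have h3 : ((bthrough G (F n) x).ncard : ℝ) ≤ N n * ε n := le_of_mul_le_mul_right h2 hFpos
      rw [hcardB, hqcoe, mul_inv_le_iff₀ hNpos', mul_comm (ε n)]
      exact h3
    -- the level-`n` bad events `D x n` have summable probabilities
    set D : V → ℕ → Set (Idx V → Bool) := fun x n => ⋃ C ∈ B x n, {η | η ⟨n, C⟩ = true} with hD
    have hDle : ∀ x n, coinMeasure q (D x n) ≤ ENNReal.ofReal (ε n) := by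
      intro x n
      calc coinMeasure q (D x n) ≤ ∑ C ∈ B x n, coinMeasure q {η | η ⟨n, C⟩ = true} :=
            measure_biUnion_finset_le _ _
        _ = ((B x n).card : ENNReal) * toNNReal (q n) := by
            have h : ∀ C ∈ B x n,
                coinMeasure q {η : Idx V → Bool | η ⟨n, C⟩ = true} = toNNReal (q n) :=
              fun C _ => coinMeasure_eval_true q ⟨n, C⟩
            rw [Finset.sum_congr rfl h, Finset.sum_const, nsmul_eq_mul]
        _ = ENNReal.ofReal (((B x n).card : ℝ) * (q n : ℝ)) := by
            rw [ENNReal.ofReal_mul (Nat.cast_nonneg _), ENNReal.ofReal_natCast,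
              ← ENNReal.ofReal_coe_nnreal, coe_toNNReal]
        _ ≤ ENNReal.ofReal (ε n) := ENNReal.ofReal_le_ofReal (hBcard x n)
    have hDsum : ∀ x, ∑' n, coinMeasure q (D x n) ≠ ⊤ := by
      intro x
      refine ne_top_of_le_ne_top (b := ENNReal.ofReal (∑' n, ε n)) ENNReal.ofReal_ne_top ?_
      calc ∑' n, coinMeasure q (D x n) ≤ ∑' n, ENNReal.ofReal (ε n) :=
            ENNReal.tsum_le_tsum fun n => hDle x n
        _ = ENNReal.ofReal (∑' n, ε n) :=
            (ENNReal.ofReal_tsum_of_nonneg (fun n => (hεpos n).le) (summable_geometric_two' _)).symm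
    -- off `limsup D x`, the vertex `x` is open from some level on
    have hlim : ∀ x, {η : Idx V → Bool | ∀ m, x ∉ configFrom G F m η} ⊆ limsup (D x) atTop := by
      intro x η hη
      rw [Filter.limsup_eq_iInf_iSup_of_nat]
      simp only [Set.iInf_eq_iInter, Set.iSup_eq_iUnion, Set.mem_iInter, Set.mem_iUnion,
        exists_prop]
      intro m
      by_contra hcon
      push Not at hcon
      refine hη m (mem_configFrom_of_forall (B x) (hBmem x) fun n hn C hC => ?_)
      have hnot : η ∉ D x n := hcon n hn
      rw [hD] at hnot
      simp only [Set.mem_iUnion, Set.mem_setOf_eq, exists_prop, not_exists, not_and] at hnot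
      simpa using hnot C hC
    have hnull : ∀ x, coinMeasure q {η : Idx V → Bool | ∀ m, x ∉ configFrom G F m η} = 0 :=
      fun x => measure_mono_null (hlim x) (measure_limsup_atTop_eq_zero (hDsum x))
    rw [ae_iff]
    refine measure_mono_null ?_ (measure_iUnion_null hnull)
    intro η hη
    rw [Set.mem_setOf_eq] at hη
    push Not at hη
    obtain ⟨x, hx⟩ := hη
    exact Set.mem_iUnion.2 ⟨x, hx⟩
  /- densities tend to one (monotone convergence along the exhaustion) -/
  have htend : ∀ x, Tendsto (fun m => ((coinMeasure q).map (configFrom G F m)).real {ω | x ∈ ω})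
      atTop (𝓝 1) := by
    intro x
    have hmono : Monotone fun m => {η : Idx V → Bool | x ∈ configFrom G F m η} :=
      fun m m' h η hη => configFrom_mono F η h hη
    have hSmeas : ∀ m, MeasurableSet {η : Idx V → Bool | x ∈ configFrom G F m η} :=
      fun m => hmeas m (measurableSet_mem x)
    have hU : coinMeasure q (⋃ m, {η : Idx V → Bool | x ∈ configFrom G F m η}) = 1 := by
      rw [← prob_compl_eq_zero_iff (MeasurableSet.iUnion hSmeas)]
      rw [ae_iff] at hexh
      refine measure_mono_null ?_ hexh
      intro η hη
      simp only [Set.mem_compl_iff, Set.mem_iUnion, Set.mem_setOf_eq, not_exists] at hη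
      simp only [Set.mem_setOf_eq, not_forall, not_exists]
      exact ⟨x, hη⟩
    have h1 := tendsto_measure_iUnion_atTop (μ := coinMeasure q) hmono
    rw [hU] at h1
    have h2 := (ENNReal.tendsto_toReal ENNReal.one_ne_top).comp h1
    rw [ENNReal.toReal_one] at h2
    refine h2.congr fun m => ?_
    simp only [Function.comp_apply]
    rw [measureReal_def, Measure.map_apply (hmeas m) (measurableSet_mem x)]
    rfl
  exact ⟨coinMeasure q, fun m => configFrom G F m, inferInstance, hmeas,
    fun γ => coinMeasure_map_image_configFrom F q γ,
    fun m => isInvariantSitePercolation_percFrom F q m,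
    fun m m' h η => configFrom_mono F η h, hfinite, hexh, htend⟩

/-- **Hyperfinite exhaustion of `ℤ^d`, unconditionally**: the hypotheses of
`AmenableInvariantPercolation_exhaustion` are theorems for `zdGraph d` (`zdGraph_connected`,
`isGraphTransitive_zdGraph`, `isGraphAmenable_zdGraph`). So `ℤ^d` carries a jointly
automorphism-invariant increasing family of finite-cluster invariant site percolations exhausting
the lattice, with densities `→ 1` — the structure of the BLPS family `ξ_ε ↑` is available
without any infinite cluster. [cite: BenjaminiLyonsPeresSchramm1999, Thm. 5.3 (proof, p. 52)]
[cite: TerlovTimar2025, Thm. 1.4] -/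
theorem AmenableInvariantPercolation_exhaustion_zd (d : ℕ) :
    ∃ (P : Measure (Idx (Site d) → Bool)) (ω : ℕ → (Idx (Site d) → Bool) → SiteConfig (Site d)),
      IsProbabilityMeasure P ∧ (∀ m, Measurable (ω m)) ∧
      (∀ γ : zdGraph d ≃g zdGraph d,
        P.map (fun η => fun m => (γ : Site d → Site d) '' ω m η) =
          P.map (fun η => fun m => ω m η)) ∧
      (∀ m, IsInvariantSitePercolation (zdGraph d) (P.map (ω m))) ∧
      (∀ m m', m ≤ m' → ∀ η, ω m η ⊆ ω m' η) ∧
      (∀ m, ∀ᵐ η ∂P, ∀ x, (siteCluster (zdGraph d) (ω m η) x).Finite) ∧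
      (∀ᵐ η ∂P, ∀ x, ∃ m, x ∈ ω m η) ∧
      ∀ x, Tendsto (fun m => (P.map (ω m)).real {ω | x ∈ ω}) atTop (𝓝 1) :=
  AmenableInvariantPercolation_exhaustion (zdGraph d) (zdGraph_connected d)
    (isGraphTransitive_zdGraph d) (isGraphAmenable_zdGraph d)

end Main

end Literature.Barriers.CriticalPhenomena

end
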